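import Mathlib

/-!
# Window cells, all `m`: the arithmetic of LEMMA T∞ (the torsion of the cokernel vanishes in every window cell)

HONEST FRAMING. Lean index of the computation cell `pub-hsemireg` (W4 widening, lattice-first seat w4-lat-2, gen 17;
doc of record `widen/W4/lat2/code17/SIGMA-CHI-w4lat2g17.md` §1b). Elementary integer arithmetic only, but — unlike the
cell-by-cell numerology leaves — quantified over ALL `m`: no abelian surface, no sheaf is formalised, and nothing in
this file says HC, HC_CM or HC_AV is proved. No `sorry`, no axiom beyond the standard three, no named fact, no `def`.

CONTEXT (informal). In the coprime window cell `(n; m, 3m)`, `n = 2m - 2`, `t = m - 4`, the torsion `T` of the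
cokernel `𝒬` has divisor class `d·ν̄` with `d ≥ 0`; since `𝒬/T` is a torsion-free quotient of the μ-stable bundle
`q_*N^m` of smaller rank, `μ(𝒬/T) > μ(q_*N^m)`, i.e. `(2tm - d)·n > t²·m` (slopes `(2tm - d)/t²` and `m/n` in units
of `ν̄²`). The orbit–genus lemma says a non-zero invariant torsion divisor would force `d² ≥ 3m⁴`. Below:
`(2tm - d)·n > t²·m` implies `d² < 3m⁴` for every `m ≥ 5` — so `T = 0` for all `m` (the texts of record used only
`2tm - d > 0`, which gives `d ≤ 2tm - 1` and fails from `m = 31` on). Principal cells (`m ≡ 1 (mod 3)`): the slope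
inequality reads `(2tm - 3d₁)·n > t²·m` and the orbit–genus threshold is `3d₁² ≥ m⁴`; again the former excludes the
latter for all `m ≥ 5`.
-/

namespace Summit.Ventures.HSemireg.WindowCellTorsionAllM

/-- The key real-free inequality: `3(m-4)² ≤ 4(m-1)²` for all integers `m ≥ 3` (indeed `m² + 16m - 44 ≥ 0`). -/
theorem three_sq_le_four_sq (m : ℤ) (hm : 3 ≤ m) : 3 * (m - 4) ^ 2 ≤ 4 * (m - 1) ^ 2 := by
  nlinarith

/-- From the strict slope inequality to the linear bound: with `t = m - 4`, `n = 2m - 2`,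
`(2tm - d)·n > t²·m` is equivalent to `2(m-1)·d < 3(m-4)·m²`. -/
theorem slope_to_linear (m d : ℤ) :
    (2 * (m - 4) * m - d) * (2 * m - 2) > (m - 4) ^ 2 * m ↔ 2 * (m - 1) * d < 3 * (m - 4) * m ^ 2 := by
  constructor <;> intro h <;> nlinarith [h]

/-- LEMMA T∞ (coprime cells), arithmetic core: for every `m ≥ 5` and `d ≥ 0`, the slope inequality
`(2tm - d)·n > t²·m` forces `d² < 3m⁴`, i.e. `d` is below the orbit–genus threshold `√3·m²`. -/
theorem torsion_bound_coprime (m d : ℤ) (hm : 5 ≤ m) (hd : 0 ≤ d)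
    (h : (2 * (m - 4) * m - d) * (2 * m - 2) > (m - 4) ^ 2 * m) : d ^ 2 < 3 * m ^ 4 := by
  have h1 : 2 * (m - 1) * d < 3 * (m - 4) * m ^ 2 := (slope_to_linear m d).1 h
  have hm1 : 0 < m - 1 := by linarith
  have hm4 : 0 < m - 4 := by linarith
  have hsq : 3 * (m - 4) ^ 2 ≤ 4 * (m - 1) ^ 2 := three_sq_le_four_sq m (by linarith)
  -- square the linear bound: (2(m-1)d)² < (3(m-4)m²)² = 9(m-4)²m⁴ ≤ 12(m-1)²m⁴
  have h2 : (2 * (m - 1) * d) ^ 2 < (3 * (m - 4) * m ^ 2) ^ 2 := by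
    have hpos : 0 ≤ 2 * (m - 1) * d := by positivity
    have hpos' : 0 < 3 * (m - 4) * m ^ 2 := by positivity
    nlinarith
  have hm4pos : (0:ℤ) < m ^ 4 := by positivity
  nlinarith [mul_le_mul_of_nonneg_right hsq (le_of_lt hm4pos)]

/-- LEMMA T∞ (principal cells), arithmetic core: for every `m ≥ 5` and `d₁ ≥ 0`, the slope inequality for
`𝒬₁/T₁` (rank `t²/3`, `c₁ = 2tm/3 - d₁`, against `μ(E₁) = m/n`), written as `(2tm - 3d₁)·n > t²·m`, forces
`3·d₁² < m⁴`, i.e. `d₁ < m²/√3`, the orbit–genus threshold on the principal surface. -/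
theorem torsion_bound_principal (m d : ℤ) (hm : 5 ≤ m) (hd : 0 ≤ d)
    (h : (2 * (m - 4) * m - 3 * d) * (2 * m - 2) > (m - 4) ^ 2 * m) : 3 * d ^ 2 < m ^ 4 := by
  have h1 : 2 * (m - 1) * (3 * d) < 3 * (m - 4) * m ^ 2 := (slope_to_linear m (3 * d)).1 h
  have hm1 : 0 < m - 1 := by linarith
  have hm4 : 0 < m - 4 := by linarith
  have hsq : 3 * (m - 4) ^ 2 ≤ 4 * (m - 1) ^ 2 := three_sq_le_four_sq m (by linarith)
  have h2 : (2 * (m - 1) * (3 * d)) ^ 2 < (3 * (m - 4) * m ^ 2) ^ 2 := by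
    have hpos : 0 ≤ 2 * (m - 1) * (3 * d) := by positivity
    have hpos' : 0 < 3 * (m - 4) * m ^ 2 := by positivity
    nlinarith
  have hm4pos : (0:ℤ) < m ^ 4 := by positivity
  nlinarith [mul_le_mul_of_nonneg_right hsq (le_of_lt hm4pos)]

/-- The thresholds of record were the special cases: the OLD bound `d ≤ 2tm - 1` satisfies `d² < 3m⁴` exactly for
`m ≤ 29` among odd `m ≥ 5` — e.g. it holds at `m = 29` (`1449² < 3·29⁴`) and fails at `m = 31` (`1673² > 3·31⁴`);
the NEW bound at `m = 31`: every `d` with `60·d < 3·27·961` has `d ≤ 1297 < 1665`. -/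
theorem old_vs_new_at_29_31 :
    (2 * 25 * 29 - 1 : ℤ) ^ 2 < 3 * 29 ^ 4 ∧ ¬ ((2 * 27 * 31 - 1 : ℤ) ^ 2 < 3 * 31 ^ 4) ∧
    (∀ d : ℤ, 2 * (31 - 1) * d < 3 * (31 - 4) * 31 ^ 2 → d ≤ 1297) ∧ (1297 : ℤ) ^ 2 < 3 * 31 ^ 4 := by
  refine ⟨by norm_num, by norm_num, ?_, by norm_num⟩
  intro d h; omega

end Summit.Ventures.HSemireg.WindowCellTorsionAllM
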